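import Literature.NumberTheory.LFunctions.MontgomeryExplicitFormulaPrimeSide
import Literature.NumberTheory.LFunctions.RiemannXiLogDeriv
import Literature.Analysis.SpecialFunctions.DigammaGauss
import Mathlib.Analysis.SpecialFunctions.JapaneseBracket
import HarnessLib

/-!
# Montgomery's explicit formula: the pieces on the right line `re s = 5/4`

Trunk T-ANT (`Literature/NumberTheory/LFunctions`), third support file for the discharge of the
named fact (P1) `Literature.NumberTheory.LFunctions.montgomery_explicit_formula` (Montgomery 1973,
Lemma; Goldston 2005, Proposition 1 (3.11)). Proofs only.

Organisation of the proof (Bombieri's folding of the contour, as in the tree's proof of the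
Guinand–Weil explicit formula, `WeilExplicitFormulaProofs.lean`): the residue theorem for
`(ξ'/ξ)(s) r(s)`, `r(s) = x^s k(s)`, `k(s) = 1/(s−s₁) − 1/(s−s₂)`, `s₁ = −1/2+it`, `s₂ = 3/2+it`,
on `[−1/4, 5/4] × [−T, T]`, with the left edge folded onto the right one by `ξ'/ξ(1−s) = −ξ'/ξ(s)`,
leaves integrals over the single line `re s = c ∈ (1, 3/2)` of
`(ξ'/ξ)(s)·[r(s) + r(1−s)]`, `ξ'/ξ = 1/s + Γ_ℝ'/Γ_ℝ + 1/(s−1) + ζ'/ζ`. This file evaluates the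
pieces other than `∫ ζ'/ζ·r` (`MontgomeryExplicitFormulaPrimeSide.lean`):

* `Montgomery.integral_logDeriv_zeta_mul_kernel_reflect` — `∫ ζ'/ζ(s) r(1−s) dy
  = −2π x^{s₁} L(Λ, 3/2 − it)` (termwise, closing to the right; no functional equation is used);
* `Montgomery.integral_inv_sub_one_mul_kernels` — the polar piece `∫ [1/(s−1)]·[r(s)+r(1−s)] dy
  = 2π(x^{s₁}(1/(s₁−1) − 1/s₁) + x k(1))`, `x k(1) = 2x/((1/2+it)(3/2−it))` being the main term;
* the Gamma factor: `Montgomery.hasSum_inv_add_logDeriv_Gammaℝ` (`1/w + Γ_ℝ'/Γ_ℝ(w) + (log π+γ)/2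
  = ∑_j (1/(2(j+1)) − 1/(w+2(j+1)))`, `re w > −2`, from Gauss' series for `ψ`,
  `Literature/Analysis/SpecialFunctions/DigammaGauss.lean`), termwise integration against a pair
  kernel `Montgomery.hasSum_integral_seriesTerm` (Fubini; the `j`-th integrand is
  `≪ (j+1)^{-7/4}(1+|y|)^{-5/4}`), and the term evaluations
  `Montgomery.integral_seriesTerm_mul_kernel_of_one_le` (closing left: residue at `s₁` and the
  **trivial-zero term** `k(−2(j+1)) x^{−2(j+1)}`) and `…_of_le_one` (closing right);
* growth and integrability on the line: `Montgomery.exists_norm_inv_add_logDeriv_Gammaℝ_vertical_le`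
  (`≪ log(1+|y|)`), `Montgomery.exists_norm_inv_sub_inv_le_sq` (`≪ (1+|y|)^{-2}`),
  `Montgomery.integrable_gammaFactor_mul_kernel`.

## References

* H. L. Montgomery, *The pair correlation of zeros of the zeta function*, Proc. Sympos. Pure Math.
  24 (1973), 181–193, Lemma.
* D. A. Goldston, *Notes on pair correlation of zeros and prime numbers*, LMS Lecture Note Ser. 322
  (2005), Proposition 1, (3.11)–(3.14).
* E. Bombieri, *Remarks on Weil's quadratic functional in the theory of prime numbers I*, Rend.
  Mat. Acc. Lincei (9) 11 (2000), §2 (folding of the contour).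
-/

noncomputable section

open Complex Filter Set MeasureTheory
open ArithmeticFunction hiding log id
open scoped Real Topology

namespace Literature.NumberTheory.LFunctions

namespace Montgomery

open Literature.Analysis.Complex

/-! ## `x^{1−s}` and the reflected kernel -/

/-- For `x > 0`: `x^{1−s} = x · (x⁻¹)^s`. [folklore] -/
theorem cpow_one_sub_eq {x : ℝ} (hx : 0 < x) (s : ℂ) :
    (x : ℂ) ^ (1 - s) = x * ((x⁻¹ : ℝ) : ℂ) ^ s := by
  have hx0 : (x : ℂ) ≠ 0 := ofReal_ne_zero.2 hx.ne'
  rw [cpow_sub _ _ hx0, cpow_one, ofReal_inv,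
    inv_cpow _ _ (by rw [arg_ofReal_of_nonneg hx.le]; exact Real.pi_ne_zero.symm), div_eq_mul_inv]

/-- The reflected pair kernel: `1/((1−s)−s₁) − 1/((1−s)−s₂) = 1/(s−(1−s₂)) − 1/(s−(1−s₁))`. [folklore] -/
theorem kernel_one_sub (s s₁ s₂ : ℂ) :
    1 / ((1 - s) - s₁) - 1 / ((1 - s) - s₂) = 1 / (s - (1 - s₂)) - 1 / (s - (1 - s₁)) := by
  have e1 : (1 - s) - s₁ = -(s - (1 - s₁)) := by ring
  have e2 : (1 - s) - s₂ = -(s - (1 - s₂)) := by ring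
  rw [e1, e2]
  simp only [one_div, inv_neg]
  ring

/-! ## (2) `∫ ζ'/ζ(s) r(1−s)` on the right line -/

/-- **The reflected Dirichlet-series piece** (the term "`−x^{−1/2+it} ζ'/ζ(−1/2+it)`" side of
Goldston's derivation, here produced on the right line without the functional equation): for
`x ≥ 1`, real `t` and `1 < c < 3/2`, with `s₁ = −1/2 + it`, `s₂ = 3/2 + it`,
`∫ (ζ'/ζ)(c+iy) x^{1−(c+iy)} (1/((1−(c+iy))−s₁) − 1/((1−(c+iy))−s₂)) dy = −2π x^{s₁} L(Λ, 3/2 − it)`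
(`L(Λ, w) = ∑ Λ(n) n^{−w} = −ζ'/ζ(w)`): expand `ζ'/ζ = −∑ Λ(n) n^{−s}`, integrate termwise and close
to the right (`y₀ = 1/(nx) ≤ 1`, residue at `1 − s₁ = 3/2 − it`). [cite: Goldston2005, Proposition 1 (3.11)] -/
theorem integral_logDeriv_zeta_mul_kernel_reflect {x : ℝ} (hx : 1 ≤ x) (t : ℝ) {c : ℝ}
    (hc1 : 1 < c) (hc2 : c < 3 / 2) :
    ∫ y : ℝ, (deriv riemannZeta ((c : ℂ) + y * I) / riemannZeta ((c : ℂ) + y * I)) *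
        ((x : ℂ) ^ (1 - ((c : ℂ) + y * I)) *
          (1 / ((1 - ((c : ℂ) + y * I)) - (-1 / 2 + t * I)) -
            1 / ((1 - ((c : ℂ) + y * I)) - (3 / 2 + t * I)))) =
      -(2 * π * ((x : ℂ) ^ (-1 / 2 + t * I) *
        LSeries (fun n ↦ (Λ n : ℂ)) (3 / 2 - t * I))) := by
  have hx0 : 0 < x := one_pos.trans_le hx
  have hxi : 0 < x⁻¹ := inv_pos.2 hx0
  -- the reflected poles
  set a : ℂ := 1 - (3 / 2 + t * I) with ha_def
  set b : ℂ := 1 - (-1 / 2 + t * I) with hb_def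
  have ha : a.re < c := by rw [ha_def]; simp; linarith
  have hb : c < b.re := by rw [hb_def]; simp; linarith
  set K : ℝ → ℂ := fun y ↦ 1 / ((c : ℂ) + y * I - a) - 1 / ((c : ℂ) + y * I - b) with hK
  have hKy : ∀ y : ℝ, 1 / ((1 - ((c : ℂ) + y * I)) - (-1 / 2 + t * I)) -
      1 / ((1 - ((c : ℂ) + y * I)) - (3 / 2 + t * I)) = K y := fun y ↦ by
    rw [kernel_one_sub]
  set F : ℕ → ℝ → ℂ := fun n y ↦ -(LSeries.term (fun n ↦ (Λ n : ℂ)) ((c : ℂ) + y * I) n *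
    ((x : ℂ) * (((x⁻¹ : ℝ) : ℂ) ^ ((c : ℂ) + y * I) * K y))) with hF
  have hterm : ∀ n : ℕ, 0 < n → ∀ y : ℝ, F n y =
      -((Λ n : ℂ) * x * ((((x⁻¹ / n : ℝ)) : ℂ) ^ ((c : ℂ) + y * I) * K y)) := by
    intro n hn y
    have hn0 : (0 : ℝ) < n := by exact_mod_cast hn
    rw [hF]
    dsimp only
    rw [LSeries.term_of_ne_zero hn.ne', div_ofReal_cpow hxi hn0, div_eq_mul_inv, ← cpow_neg,
      ofReal_natCast]
    ring
  have hF0 : ∀ y, F 0 y = 0 := fun y ↦ by simp [hF]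
  -- pointwise: the integrand is `∑' n, F n y`
  have hsum_y : ∀ y : ℝ, HasSum (fun n ↦ F n y)
      ((deriv riemannZeta ((c : ℂ) + y * I) / riemannZeta ((c : ℂ) + y * I)) *
        ((x : ℂ) ^ (1 - ((c : ℂ) + y * I)) * K y)) := by
    intro y
    have hs : 1 < ((c : ℂ) + y * I).re := by simp; linarith
    have h1 := (ArithmeticFunction.LSeriesSummable_vonMangoldt hs).hasSum
    rw [show (∑' n, LSeries.term (fun n ↦ (Λ n : ℂ)) ((c : ℂ) + y * I) n) =
      LSeries (fun n ↦ (Λ n : ℂ)) ((c : ℂ) + y * I) from rfl,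
      ArithmeticFunction.LSeries_vonMangoldt_eq_deriv_riemannZeta_div hs] at h1
    have h3 : (deriv riemannZeta ((c : ℂ) + y * I) / riemannZeta ((c : ℂ) + y * I)) *
        ((x : ℂ) ^ (1 - ((c : ℂ) + y * I)) * K y) =
        -(-deriv riemannZeta ((c : ℂ) + y * I) / riemannZeta ((c : ℂ) + y * I) *
          ((x : ℂ) * ((((x⁻¹ : ℝ)) : ℂ) ^ ((c : ℂ) + y * I) * K y))) := by
      rw [cpow_one_sub_eq hx0]; ring
    rw [h3]
    exact (h1.mul_right _).neg
  -- integrability of each term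
  have hFint : ∀ n, Integrable (F n) := by
    intro n
    rcases Nat.eq_zero_or_pos n with rfl | hn
    · have h0 : F 0 = fun _ ↦ 0 := funext hF0
      rw [h0]; exact integrable_zero _ _ _
    · have hn0 : (0 : ℝ) < n := by exact_mod_cast hn
      have h := ((integrable_cpow_mul_inv_sub_inv (y₀ := x⁻¹ / n) (by positivity) (c := c)
        ha.ne hb.ne').const_mul ((Λ n : ℂ) * x)).neg
      refine h.congr (ae_of_all _ fun y ↦ ?_)
      rw [hterm n hn y]
      simp only [Pi.neg_apply]
      ring
  -- the `L¹` norms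
  have hKint : Integrable K := VLI.integrable_inv_sub_inv ha.ne hb.ne'
  set J : ℝ := ∫ y, ‖K y‖ with hJ
  have hnormF : ∀ n, 0 < n → ∫ y, ‖F n y‖ = Λ n * x * (x⁻¹ / n) ^ c * J := by
    intro n hn
    have hn0 : (0 : ℝ) < n := by exact_mod_cast hn
    have : ∀ y, ‖F n y‖ = Λ n * x * (x⁻¹ / n) ^ c * ‖K y‖ := fun y ↦ by
      rw [hterm n hn y, norm_neg, norm_mul, norm_mul, norm_mul, Complex.norm_real,
        Real.norm_of_nonneg vonMangoldt_nonneg, Complex.norm_real, Real.norm_of_nonneg hx0.le,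
        norm_cpow_vertical (by positivity)]
      ring
    simp_rw [this]
    exact MeasureTheory.integral_const_mul _ _
  have hsumm : Summable fun n ↦ ∫ y, ‖F n y‖ := by
    have hc' : 1 < (c : ℂ).re := by simp; linarith
    have h1 : Summable fun n : ℕ ↦ ‖LSeries.term (fun n ↦ (Λ n : ℂ)) (c : ℂ) n‖ :=
      (ArithmeticFunction.LSeriesSummable_vonMangoldt hc').norm
    refine (h1.mul_left (x * x⁻¹ ^ c * J)).congr fun n ↦ ?_
    rcases Nat.eq_zero_or_pos n with rfl | hn
    · simp [hF0]
    · have hn0 : (0 : ℝ) < n := by exact_mod_cast hn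
      rw [hnormF n hn, LSeries.norm_term_eq, if_neg hn.ne', Complex.norm_real,
        Real.norm_of_nonneg vonMangoldt_nonneg, ofReal_re, Real.div_rpow hxi.le hn0.le]
      field_simp
  -- termwise evaluation: close to the right
  have heval : ∀ n, ∫ y, F n y =
      -(2 * π * ((x : ℂ) ^ (-1 / 2 + t * I) *
        (LSeries.term (fun n ↦ (Λ n : ℂ)) (3 / 2 - t * I) n))) := by
    intro n
    rcases Nat.eq_zero_or_pos n with rfl | hn
    · simp [hF0]
    · have hn0 : (0 : ℝ) < n := by exact_mod_cast hn
      have hy1 : x⁻¹ / n ≤ 1 := by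
        rw [div_le_one hn0]
        exact (inv_le_one_of_one_le₀ hx).trans (by exact_mod_cast hn)
      rw [integral_congr_ae (ae_of_all _ (hterm n hn)), integral_neg, MeasureTheory.integral_const_mul,
        hK, integral_cpow_mul_inv_sub_inv_of_le_one (by positivity) hy1 ha hb,
        LSeries.term_of_ne_zero hn.ne', div_ofReal_cpow hxi hn0]
      have hx0' : (x : ℂ) ≠ 0 := ofReal_ne_zero.2 hx0.ne'
      have harg : (x : ℂ).arg ≠ π := by
        rw [arg_ofReal_of_nonneg hx0.le]; exact Real.pi_ne_zero.symm
      have e1 : (x : ℂ) * ((x⁻¹ : ℝ) : ℂ) ^ b = (x : ℂ) ^ (-1 / 2 + t * I) := by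
        rw [ofReal_inv, inv_cpow _ _ harg, ← cpow_neg]
        rw [show (x : ℂ) * (x : ℂ) ^ (-b) = (x : ℂ) ^ (1 : ℂ) * (x : ℂ) ^ (-b) by rw [cpow_one],
          ← cpow_add _ _ hx0']
        congr 1
        rw [hb_def]; ring
      have e2 : ((n : ℝ) : ℂ) ^ (-b) = 1 / (n : ℂ) ^ (3 / 2 - t * I : ℂ) := by
        rw [ofReal_natCast, cpow_neg, one_div, hb_def]
        congr 1; ring
      rw [show ((Λ n : ℝ) : ℂ) * (x : ℂ) * (2 * π * (((x⁻¹ : ℝ) : ℂ) ^ b * ((n : ℝ) : ℂ) ^ (-b))) =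
        2 * π * (((x : ℂ) * ((x⁻¹ : ℝ) : ℂ) ^ b) * (((Λ n : ℝ) : ℂ) * ((n : ℝ) : ℂ) ^ (-b))) by ring,
        e1, e2]
      ring
  calc ∫ y : ℝ, (deriv riemannZeta ((c : ℂ) + y * I) / riemannZeta ((c : ℂ) + y * I)) *
        ((x : ℂ) ^ (1 - ((c : ℂ) + y * I)) *
          (1 / ((1 - ((c : ℂ) + y * I)) - (-1 / 2 + t * I)) -
            1 / ((1 - ((c : ℂ) + y * I)) - (3 / 2 + t * I))))
      = ∫ y, ∑' n, F n y := by
        refine integral_congr_ae (ae_of_all _ fun y ↦ ?_)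
        simp only
        rw [hKy y]
        exact ((hsum_y y).tsum_eq).symm
    _ = ∑' n, ∫ y, F n y := (integral_tsum_of_summable_integral_norm hFint hsumm).symm
    _ = ∑' n, -(2 * π * ((x : ℂ) ^ (-1 / 2 + t * I) *
          (LSeries.term (fun n ↦ (Λ n : ℂ)) (3 / 2 - t * I) n))) := tsum_congr heval
    _ = -(2 * π * ((x : ℂ) ^ (-1 / 2 + t * I) * LSeries (fun n ↦ (Λ n : ℂ)) (3 / 2 - t * I))) := by
        rw [tsum_neg, tsum_mul_left, tsum_mul_left]
        rfl


/-! ## (3) The polar piece `∫ [1/(s−1)]·[r(s) + r(1−s)]` on the right line -/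

/-- Partial fractions for the pair kernel divided by `s − p`:
`k(s)/(s−p) = k(s)/(s₁−p) + k(p)·(1/(s−p) − 1/(s−s₂))`, `k(s) = 1/(s−s₁) − 1/(s−s₂)`. [folklore] -/
theorem kernel_div_sub_eq {s p s₁ s₂ : ℂ} (h1 : s ≠ s₁) (h2 : s ≠ s₂) (hp : s ≠ p) (hp1 : p ≠ s₁)
    (hp2 : p ≠ s₂) :
    (1 / (s - s₁) - 1 / (s - s₂)) / (s - p) =
      1 / (s₁ - p) * (1 / (s - s₁) - 1 / (s - s₂)) +
        (1 / (p - s₁) - 1 / (p - s₂)) * (1 / (s - p) - 1 / (s - s₂)) := by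
  have d1 : s - s₁ ≠ 0 := sub_ne_zero.2 h1
  have d2 : s - s₂ ≠ 0 := sub_ne_zero.2 h2
  have d3 : s - p ≠ 0 := sub_ne_zero.2 hp
  have d4 : s₁ - p ≠ 0 := sub_ne_zero.2 (Ne.symm hp1)
  have d5 : p - s₁ ≠ 0 := sub_ne_zero.2 hp1
  have d6 : p - s₂ ≠ 0 := sub_ne_zero.2 hp2
  field_simp
  ring

/-- Integrability of `y ↦ φ(c+iy) · y₀^{c+iy} · (pair kernel)` for `φ` continuous and bounded on the
line. [folklore] -/
theorem integrable_bdd_mul_cpow_mul_inv_sub_inv {φ : ℂ → ℂ} {c M : ℝ}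
    (hφc : Continuous fun y : ℝ ↦ φ ((c : ℂ) + y * I)) (hφM : ∀ y : ℝ, ‖φ ((c : ℂ) + y * I)‖ ≤ M)
    {y₀ : ℝ} (hy : 0 < y₀) {a b : ℂ} (ha : a.re ≠ c) (hb : b.re ≠ c) :
    Integrable fun y : ℝ ↦ φ ((c : ℂ) + y * I) * ((y₀ : ℂ) ^ ((c : ℂ) + y * I) *
      (1 / ((c : ℂ) + y * I - a) - 1 / ((c : ℂ) + y * I - b))) :=
  (integrable_cpow_mul_inv_sub_inv hy ha hb).bdd_mul hφc.aestronglyMeasurable (ae_of_all _ hφM)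

/-- On the line `re s = c > 1`: `y ↦ 1/(c + iy − 1)` is continuous and bounded by `1/(c−1)`. [folklore] -/
theorem continuous_inv_sub_one_vertical {c : ℝ} (hc : 1 < c) :
    Continuous (fun y : ℝ ↦ 1 / (((c : ℂ) + y * I) - 1)) ∧
      ∀ y : ℝ, ‖1 / (((c : ℂ) + y * I) - 1)‖ ≤ 1 / (c - 1) := by
  have hne : ∀ y : ℝ, ((c : ℂ) + y * I) - 1 ≠ 0 := fun y h ↦ by
    have := congrArg Complex.re h; simp at this; linarith
  refine ⟨continuous_const.div (by fun_prop) hne, fun y ↦ ?_⟩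
  rw [norm_div, norm_one]
  apply one_div_le_one_div_of_le (by linarith)
  have := abs_re_le_norm (((c : ℂ) + y * I) - 1)
  simp at this
  rw [abs_of_pos (by linarith)] at this
  exact this

/-- **The polar piece**: for `x ≥ 1`, real `t`, `1 < c < 3/2`, `s₁ = −1/2+it`, `s₂ = 3/2+it`,
`∫ [1/(s−1)]·[x^s k(s) + x^{1−s} k(1−s)] dy (s = c+iy)
  = 2π ( x^{s₁} (1/(s₁−1) − 1/s₁) + x·(1/(1−s₁) − 1/(1−s₂)) )`,
the `x^s` part closing to the left (residues at `s₁` and at the pole `1` of `ζ`, the latter giving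
the main term `x k(1) = 2x/((1/2+it)(3/2−it))`), the `x^{1−s}` part to the right (residue at
`1 − s₁`). [cite: Goldston2005, Proposition 1 (3.11)] -/
theorem integral_inv_sub_one_mul_kernels {x : ℝ} (hx : 1 ≤ x) (t : ℝ) {c : ℝ} (hc1 : 1 < c)
    (hc2 : c < 3 / 2) :
    ∫ y : ℝ, 1 / (((c : ℂ) + y * I) - 1) *
        ((x : ℂ) ^ ((c : ℂ) + y * I) *
            (1 / ((c : ℂ) + y * I - (-1 / 2 + t * I)) - 1 / ((c : ℂ) + y * I - (3 / 2 + t * I))) +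
          (x : ℂ) ^ (1 - ((c : ℂ) + y * I)) *
            (1 / ((1 - ((c : ℂ) + y * I)) - (-1 / 2 + t * I)) -
              1 / ((1 - ((c : ℂ) + y * I)) - (3 / 2 + t * I)))) =
      2 * π * ((x : ℂ) ^ (-1 / 2 + t * I) * (1 / ((-1 / 2 + t * I) - 1) - 1 / (-1 / 2 + t * I)) +
        x * (1 / (1 - (-1 / 2 + t * I)) - 1 / (1 - (3 / 2 + t * I)))) := by
  have hx0 : 0 < x := one_pos.trans_le hx
  have hxi : 0 < x⁻¹ := inv_pos.2 hx0
  have hxi1 : x⁻¹ ≤ 1 := inv_le_one_of_one_le₀ hx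
  set s₁ : ℂ := -1 / 2 + t * I with hs₁
  set s₂ : ℂ := 3 / 2 + t * I with hs₂
  set a : ℂ := 1 - s₂ with ha_def
  set b : ℂ := 1 - s₁ with hb_def
  have h1c : s₁.re < c := by rw [hs₁]; simp; linarith
  have hc2' : c < s₂.re := by rw [hs₂]; simp; linarith
  have hac : a.re < c := by rw [ha_def, hs₂]; simp; linarith
  have hcb : c < b.re := by rw [hb_def, hs₁]; simp; linarith
  have h1lt : (1 : ℂ).re < c := by simp; linarith
  -- `1` is none of the poles
  have h1s₁ : (1 : ℂ) ≠ s₁ := by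
    rw [hs₁]; intro h; have := congrArg re h; norm_num at this
  have h1s₂ : (1 : ℂ) ≠ s₂ := by
    rw [hs₂]; intro h; have := congrArg re h; norm_num at this
  have h1a : (1 : ℂ) ≠ a := by
    rw [ha_def, hs₂]; intro h; have := congrArg re h; norm_num at this
  have h1b : (1 : ℂ) ≠ b := by
    rw [hb_def, hs₁]; intro h; have := congrArg re h; norm_num at this
  obtain ⟨hφc, hφM⟩ := continuous_inv_sub_one_vertical hc1
  -- points of the line avoid the poles
  have hs_ne : ∀ (y : ℝ) (d : ℂ), d.re ≠ c → (c : ℂ) + y * I ≠ d := fun y d hd h ↦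
    hd (by rw [← h]; simp)
  -- the two integrands
  obtain ⟨f₁, hf₁⟩ : ∃ f : ℝ → ℂ, f = fun y : ℝ ↦ 1 / (((c : ℂ) + y * I) - 1) *
      ((x : ℂ) ^ ((c : ℂ) + y * I) *
        (1 / ((c : ℂ) + y * I - s₁) - 1 / ((c : ℂ) + y * I - s₂))) := ⟨_, rfl⟩
  obtain ⟨f₂, hf₂⟩ : ∃ f : ℝ → ℂ, f = fun y : ℝ ↦ (x : ℂ) * (1 / (((c : ℂ) + y * I) - 1) *
      ((((x⁻¹ : ℝ)) : ℂ) ^ ((c : ℂ) + y * I) *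
        (1 / ((c : ℂ) + y * I - a) - 1 / ((c : ℂ) + y * I - b)))) := ⟨_, rfl⟩
  have hint₁ : Integrable f₁ := by
    rw [hf₁]
    exact integrable_bdd_mul_cpow_mul_inv_sub_inv (φ := fun s ↦ 1 / (s - 1)) hφc hφM hx0
      h1c.ne hc2'.ne'
  have hint₂ : Integrable f₂ := by
    rw [hf₂]
    exact (integrable_bdd_mul_cpow_mul_inv_sub_inv (φ := fun s ↦ 1 / (s - 1)) hφc hφM hxi
      hac.ne hcb.ne').const_mul (x : ℂ)
  have hsplit : ∀ y : ℝ, 1 / (((c : ℂ) + y * I) - 1) *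
        ((x : ℂ) ^ ((c : ℂ) + y * I) *
            (1 / ((c : ℂ) + y * I - s₁) - 1 / ((c : ℂ) + y * I - s₂)) +
          (x : ℂ) ^ (1 - ((c : ℂ) + y * I)) *
            (1 / ((1 - ((c : ℂ) + y * I)) - s₁) -
              1 / ((1 - ((c : ℂ) + y * I)) - s₂))) = f₁ y + f₂ y := by
    intro y
    rw [hf₁, hf₂]
    dsimp only
    rw [kernel_one_sub, cpow_one_sub_eq hx0]
    ring
  simp_rw [hsplit]
  rw [integral_add hint₁ hint₂]
  -- (3a): the `x^s` part, closed to the left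
  have hA : ∫ y, f₁ y = 2 * π * ((x : ℂ) ^ s₁ * (1 / (s₁ - 1)) +
      x * (1 / (1 - s₁) - 1 / (1 - s₂))) := by
    have hpf : ∀ y : ℝ, f₁ y = 1 / (s₁ - 1) * ((x : ℂ) ^ ((c : ℂ) + y * I) *
        (1 / ((c : ℂ) + y * I - s₁) - 1 / ((c : ℂ) + y * I - s₂))) +
        (1 / (1 - s₁) - 1 / (1 - s₂)) * ((x : ℂ) ^ ((c : ℂ) + y * I) *
        (1 / ((c : ℂ) + y * I - 1) - 1 / ((c : ℂ) + y * I - s₂))) := by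
      intro y
      rw [hf₁]
      dsimp only
      have hk := kernel_div_sub_eq (s := (c : ℂ) + y * I) (p := 1) (s₁ := s₁) (s₂ := s₂)
        (hs_ne y s₁ h1c.ne) (hs_ne y s₂ hc2'.ne') (hs_ne y 1 h1lt.ne) h1s₁ h1s₂
      rw [show 1 / (((c : ℂ) + y * I) - 1) * ((x : ℂ) ^ ((c : ℂ) + y * I) *
          (1 / ((c : ℂ) + y * I - s₁) - 1 / ((c : ℂ) + y * I - s₂))) =
          (x : ℂ) ^ ((c : ℂ) + y * I) *
            ((1 / ((c : ℂ) + y * I - s₁) - 1 / ((c : ℂ) + y * I - s₂)) / (((c : ℂ) + y * I) - 1)) by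
        rw [div_eq_mul_one_div _ (((c : ℂ) + y * I) - 1)]; ring, hk]
      ring
    simp_rw [hpf]
    rw [integral_add ((integrable_cpow_mul_inv_sub_inv hx0 h1c.ne hc2'.ne').const_mul _)
      ((integrable_cpow_mul_inv_sub_inv hx0 h1lt.ne hc2'.ne').const_mul _),
      MeasureTheory.integral_const_mul, MeasureTheory.integral_const_mul,
      integral_cpow_mul_inv_sub_inv_of_one_le hx h1c hc2',
      integral_cpow_mul_inv_sub_inv_of_one_le hx h1lt hc2', cpow_one]
    ring
  -- (3b): the `x^{1-s}` part, closed to the right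
  have hB : ∫ y, f₂ y = 2 * π * ((x : ℂ) ^ s₁ * (-(1 / s₁))) := by
    have hpf : ∀ y : ℝ, f₂ y = (x : ℂ) * (1 / (a - 1) * ((((x⁻¹ : ℝ)) : ℂ) ^ ((c : ℂ) + y * I) *
        (1 / ((c : ℂ) + y * I - a) - 1 / ((c : ℂ) + y * I - b))) +
        (1 / (1 - a) - 1 / (1 - b)) * ((((x⁻¹ : ℝ)) : ℂ) ^ ((c : ℂ) + y * I) *
        (1 / ((c : ℂ) + y * I - 1) - 1 / ((c : ℂ) + y * I - b)))) := by
      intro y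
      rw [hf₂]
      dsimp only
      have hk := kernel_div_sub_eq (s := (c : ℂ) + y * I) (p := 1) (s₁ := a) (s₂ := b)
        (hs_ne y a hac.ne) (hs_ne y b hcb.ne') (hs_ne y 1 h1lt.ne) h1a h1b
      rw [show 1 / (((c : ℂ) + y * I) - 1) * ((((x⁻¹ : ℝ)) : ℂ) ^ ((c : ℂ) + y * I) *
          (1 / ((c : ℂ) + y * I - a) - 1 / ((c : ℂ) + y * I - b))) =
          (((x⁻¹ : ℝ)) : ℂ) ^ ((c : ℂ) + y * I) *
            ((1 / ((c : ℂ) + y * I - a) - 1 / ((c : ℂ) + y * I - b)) / (((c : ℂ) + y * I) - 1)) by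
        rw [div_eq_mul_one_div _ (((c : ℂ) + y * I) - 1)]; ring, hk]
      ring
    simp_rw [hpf]
    rw [MeasureTheory.integral_const_mul,
      integral_add ((integrable_cpow_mul_inv_sub_inv hxi hac.ne hcb.ne').const_mul _)
      ((integrable_cpow_mul_inv_sub_inv hxi h1lt.ne hcb.ne').const_mul _),
      MeasureTheory.integral_const_mul, MeasureTheory.integral_const_mul,
      integral_cpow_mul_inv_sub_inv_of_le_one hxi hxi1 hac hcb,
      integral_cpow_mul_inv_sub_inv_of_le_one hxi hxi1 h1lt hcb]
    -- `x (x⁻¹)^b = x^{s₁}` and `1/(a-1) + (1/(1-a) - 1/(1-b)) = -1/s₁`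
    have hx0' : (x : ℂ) ≠ 0 := ofReal_ne_zero.2 hx0.ne'
    have harg : (x : ℂ).arg ≠ π := by
      rw [arg_ofReal_of_nonneg hx0.le]; exact Real.pi_ne_zero.symm
    have e1 : ((x⁻¹ : ℝ) : ℂ) ^ b = (x : ℂ)⁻¹ * (x : ℂ) ^ s₁ := by
      rw [hb_def, ofReal_inv, inv_cpow _ _ harg, cpow_sub _ _ hx0', cpow_one]
      field_simp
    have hs10 : s₁ ≠ 0 := by
      rw [hs₁]; intro h; have := congrArg re h; norm_num at this
    have ha1 : a - 1 ≠ 0 := sub_ne_zero.2 (Ne.symm h1a)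
    have h1a' : 1 - a ≠ 0 := sub_ne_zero.2 h1a
    have h1b' : 1 - b = s₁ := by rw [hb_def]; ring
    rw [e1, h1b']
    field_simp
    ring
  rw [hA, hB]
  ring


/-! ## The series for `1/w + Γℝ'/Γℝ(w)` -/

/-- **Partial fractions for `1/w + Γ_ℝ'/Γ_ℝ(w)`**: for `Re w > −2`, `w/2 ∉ −ℕ`,
`∑_{j≥0} (1/(2(j+1)) − 1/(w + 2(j+1))) = 1/w + Γ_ℝ'/Γ_ℝ(w) + (log π + γ)/2`
(`Γ_ℝ'/Γ_ℝ(w) = −½log π + ½ψ(w/2)`, `ψ(w/2) = ψ(w/2+1) − 2/w`, and Gauss' series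
`ψ(z) + γ = ∑ (1/(k+1) − 1/(z+k))` at `z = w/2 + 1`). [folklore] -/
theorem hasSum_inv_add_logDeriv_Gammaℝ {w : ℂ} (hw : -2 < w.re) (hw' : ∀ m : ℕ, w / 2 ≠ -m) :
    HasSum (fun j : ℕ ↦ 1 / (2 * ((j : ℂ) + 1)) - 1 / (w + 2 * ((j : ℂ) + 1)))
      (1 / w + logDeriv Gammaℝ w +
        ((Real.log π : ℂ) + (Real.eulerMascheroniConstant : ℂ)) / 2) := by
  have hw0 : w ≠ 0 := fun h ↦ hw' 0 (by rw [h]; simp)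
  have h1 : logDeriv Gammaℝ w = -(Complex.log π) / 2 + Complex.digamma (w / 2) / 2 :=
    LFunctions.logDeriv_Gammaℝ hw'
  have h2 : Complex.digamma (w / 2 + 1) = Complex.digamma (w / 2) + (w / 2)⁻¹ :=
    Complex.digamma_apply_add_one (w / 2) hw'
  have hre : 0 < (w / 2 + 1).re := by simp; linarith
  have h3 := Literature.Analysis.SpecialFunctions.Complex.hasSum_one_div_sub_one_div_digamma hre
  have h4 := h3.div_const 2
  have hval : (Complex.digamma (w / 2 + 1) + Real.eulerMascheroniConstant) / 2 =
      1 / w + logDeriv Gammaℝ w + ((Real.log π : ℂ) + (Real.eulerMascheroniConstant : ℂ)) / 2 := by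
    rw [h1, h2, ← Complex.ofReal_log Real.pi_pos.le]
    field_simp
    ring
  rw [← hval]
  refine h4.congr_fun fun j ↦ ?_
  have hj : w + 2 * ((j : ℂ) + 1) ≠ 0 := fun h ↦ by
    have := congrArg Complex.re h; simp at this; linarith
  have hj1 : (j : ℂ) + 1 ≠ 0 := fun h ↦ by
    have := congrArg Complex.re h; simp at this; linarith
  have e : w / 2 + 1 + j = (w + 2 * ((j : ℂ) + 1)) / 2 := by ring
  rw [e]
  field_simp

/-! ## Bounds on the line `re s = c` -/

/-- `‖s‖ · ‖1/(s−p₁) − 1/(s−p₂)‖ ≤ D/(1+|y|)` on the line `s = c + iy` (`re p₁, re p₂ ≠ c`). [folklore] -/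
theorem exists_norm_mul_inv_sub_inv_le (c : ℝ) (p₁ p₂ : ℂ) (h1 : p₁.re ≠ c) (h2 : p₂.re ≠ c) :
    ∃ D : ℝ, 0 < D ∧ ∀ y : ℝ, ‖(c : ℂ) + y * I‖ *
      ‖1 / ((c : ℂ) + y * I - p₁) - 1 / ((c : ℂ) + y * I - p₂)‖ ≤ D / (1 + |y|) := by
  set δ : ℝ := min |c - p₁.re| |c - p₂.re| with hδ
  have hδ0 : 0 < δ := lt_min (abs_pos.2 (sub_ne_zero.2 (Ne.symm h1))) (abs_pos.2 (sub_ne_zero.2 (Ne.symm h2)))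
  set M : ℝ := max |p₁.im| |p₂.im| with hM
  have hM0 : 0 ≤ M := le_trans (abs_nonneg _) (le_max_left _ _)
  set κ : ℝ := δ / (M + 1 + δ) with hκ
  have hκ0 : 0 < κ := by positivity
  -- `‖s - p_i‖ ≥ κ (1 + |y|)`
  have hlow : ∀ (p : ℂ), δ ≤ |c - p.re| → |p.im| ≤ M → ∀ y : ℝ,
      κ * (1 + |y|) ≤ ‖(c : ℂ) + y * I - p‖ := by
    intro p hp hpM y
    have hre : |c - p.re| ≤ ‖(c : ℂ) + y * I - p‖ := by
      have := abs_re_le_norm ((c : ℂ) + y * I - p); simpa using this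
    have him : |y - p.im| ≤ ‖(c : ℂ) + y * I - p‖ := by
      have := abs_im_le_norm ((c : ℂ) + y * I - p); simpa using this
    have h3 : |y| - M ≤ |y - p.im| := by
      have := abs_sub_abs_le_abs_sub y p.im; linarith
    rw [hκ, div_mul_eq_mul_div, div_le_iff₀ (by positivity)]
    rcases le_or_gt (|y| - M) δ with hy | hy
    · -- `|y| ≤ M + δ`: use the real-part bound
      nlinarith [abs_nonneg y]
    · -- `|y| > M + δ`: use the imaginary-part bound
      nlinarith [abs_nonneg y]
  refine ⟨(max |c| 1) * ‖p₁ - p₂‖ / κ ^ 2 + 1, by positivity, fun y ↦ ?_⟩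
  have hs : ‖(c : ℂ) + y * I‖ ≤ max |c| 1 * (1 + |y|) := by
    have h := Complex.norm_le_abs_re_add_abs_im ((c : ℂ) + y * I)
    simp at h
    have : |c| + |y| ≤ max |c| 1 * (1 + |y|) := by
      have h1 := le_max_left |c| 1
      have h2 := le_max_right |c| 1
      nlinarith [abs_nonneg y, abs_nonneg c]
    linarith
  have hq1 := hlow p₁ (min_le_left _ _) (le_max_left _ _) y
  have hq2 := hlow p₂ (min_le_right _ _) (le_max_right _ _) y
  have hpos1 : 0 < ‖(c : ℂ) + y * I - p₁‖ := lt_of_lt_of_le (by positivity) hq1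
  have hpos2 : 0 < ‖(c : ℂ) + y * I - p₂‖ := lt_of_lt_of_le (by positivity) hq2
  have e : 1 / ((c : ℂ) + y * I - p₁) - 1 / ((c : ℂ) + y * I - p₂) =
      (p₁ - p₂) / (((c : ℂ) + y * I - p₁) * ((c : ℂ) + y * I - p₂)) := by
    have d1 : (c : ℂ) + y * I - p₁ ≠ 0 := norm_pos_iff.1 hpos1
    have d2 : (c : ℂ) + y * I - p₂ ≠ 0 := norm_pos_iff.1 hpos2
    field_simp; ring
  rw [e, norm_div, norm_mul]
  have hy1 : 0 < 1 + |y| := by positivity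
  calc ‖(c : ℂ) + y * I‖ * (‖p₁ - p₂‖ / (‖(c : ℂ) + y * I - p₁‖ * ‖(c : ℂ) + y * I - p₂‖))
      ≤ (max |c| 1 * (1 + |y|)) * (‖p₁ - p₂‖ / (κ * (1 + |y|) * (κ * (1 + |y|)))) := by
        apply mul_le_mul hs _ (by positivity) (by positivity)
        exact div_le_div_of_nonneg_left (norm_nonneg _) (by positivity)
          (mul_le_mul hq1 hq2 (by positivity) (norm_nonneg _))
    _ = (max |c| 1 * ‖p₁ - p₂‖ / κ ^ 2) / (1 + |y|) := by
        field_simp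
    _ ≤ ((max |c| 1) * ‖p₁ - p₂‖ / κ ^ 2 + 1) / (1 + |y|) := by
        gcongr; linarith

/-- The `j`-th term of the series: `‖1/(2(j+1)) − 1/(s+2(j+1))‖ = ‖s‖/(2(j+1)‖s+2(j+1)‖)`. [folklore] -/
theorem norm_seriesTerm_eq (s : ℂ) (j : ℕ) (hs : s + 2 * ((j : ℂ) + 1) ≠ 0) :
    ‖1 / (2 * ((j : ℂ) + 1)) - 1 / (s + 2 * ((j : ℂ) + 1))‖ =
      ‖s‖ / (2 * ((j : ℝ) + 1) * ‖s + 2 * ((j : ℂ) + 1)‖) := by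
  have hj : (2 * ((j : ℂ) + 1)) ≠ 0 := by
    intro h; have := congrArg Complex.re h; simp at this; linarith
  have e : 1 / (2 * ((j : ℂ) + 1)) - 1 / (s + 2 * ((j : ℂ) + 1)) =
      s / ((2 * ((j : ℂ) + 1)) * (s + 2 * ((j : ℂ) + 1))) := by
    field_simp; ring
  rw [e, norm_div, norm_mul]
  congr 2
  have : (2 * ((j : ℂ) + 1)) = ((2 * ((j : ℝ) + 1) : ℝ) : ℂ) := by push_cast; ring
  rw [this, Complex.norm_real, Real.norm_of_nonneg (by positivity)]

/-- On `re s = c ≥ 0`: `1/‖s + 2(j+1)‖ ≤ 2 (2j+1+c)^{-3/4} (1+|y|)^{-1/4}` (weighted AM–GM). [folklore] -/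
theorem inv_norm_add_le {c : ℝ} (hc : 0 ≤ c) (y : ℝ) (j : ℕ) :
    1 / ‖(c : ℂ) + y * I + 2 * ((j : ℂ) + 1)‖ ≤
      2 * ((2 * (j : ℝ) + 1 + c) ^ (-(3 / 4 : ℝ)) * (1 + |y|) ^ (-(1 / 4 : ℝ))) := by
  set A : ℝ := 2 * (j : ℝ) + 1 + c with hA
  have hA1 : 1 ≤ A := by rw [hA]; linarith [j.cast_nonneg (α := ℝ)]
  have hy1 : 1 ≤ 1 + |y| := by linarith [abs_nonneg y]
  -- `A^{3/4} (1+|y|)^{1/4} ≤ A + 1 + |y|`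
  have hamgm : A ^ (3 / 4 : ℝ) * (1 + |y|) ^ (1 / 4 : ℝ) ≤ A + (1 + |y|) := by
    have h := Real.geom_mean_le_arith_mean2_weighted (by norm_num : (0 : ℝ) ≤ 3 / 4)
      (by norm_num : (0 : ℝ) ≤ 1 / 4) (by linarith : 0 ≤ A) (by linarith : 0 ≤ 1 + |y|)
      (by norm_num : (3 : ℝ) / 4 + 1 / 4 = 1)
    linarith [h]
  -- `‖s + 2(j+1)‖ ≥ (A + 1 + |y|)/2`
  have hnorm : (A + (1 + |y|)) / 2 ≤ ‖(c : ℂ) + y * I + 2 * ((j : ℂ) + 1)‖ := by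
    have hre : c + 2 * ((j : ℝ) + 1) ≤ ‖(c : ℂ) + y * I + 2 * ((j : ℂ) + 1)‖ := by
      have := abs_re_le_norm ((c : ℂ) + y * I + 2 * ((j : ℂ) + 1))
      simp at this
      rw [abs_of_nonneg (by positivity)] at this
      exact this
    have him : |y| ≤ ‖(c : ℂ) + y * I + 2 * ((j : ℂ) + 1)‖ := by
      have := abs_im_le_norm ((c : ℂ) + y * I + 2 * ((j : ℂ) + 1))
      simpa using this
    rw [hA]; linarith
  have hprod : 0 < A ^ (3 / 4 : ℝ) * (1 + |y|) ^ (1 / 4 : ℝ) := by positivity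
  have hpos : 0 < ‖(c : ℂ) + y * I + 2 * ((j : ℂ) + 1)‖ := lt_of_lt_of_le (by positivity) hnorm
  rw [Real.rpow_neg (by linarith), Real.rpow_neg (by linarith), div_le_iff₀ hpos]
  calc (1 : ℝ) = (A ^ (3 / 4 : ℝ))⁻¹ * ((1 + |y|) ^ (1 / 4 : ℝ))⁻¹ *
      (A ^ (3 / 4 : ℝ) * (1 + |y|) ^ (1 / 4 : ℝ)) := by field_simp
    _ ≤ (A ^ (3 / 4 : ℝ))⁻¹ * ((1 + |y|) ^ (1 / 4 : ℝ))⁻¹ *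
      (2 * ‖(c : ℂ) + y * I + 2 * ((j : ℂ) + 1)‖) := by
        apply mul_le_mul_of_nonneg_left _ (by positivity)
        linarith
    _ = 2 * ((A ^ (3 / 4 : ℝ))⁻¹ * ((1 + |y|) ^ (1 / 4 : ℝ))⁻¹) *
      ‖(c : ℂ) + y * I + 2 * ((j : ℂ) + 1)‖ := by ring


/-- `(c + iy)/2` is not a pole of `Γ` for `c > 0`. [folklore] -/
theorem half_vertical_ne_neg_nat {c : ℝ} (hc : 0 < c) (y : ℝ) (m : ℕ) :
    ((c : ℂ) + y * I) / 2 ≠ -m := fun h ↦ by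
  have := congrArg Complex.re h; simp at this; linarith [(m.cast_nonneg : (0 : ℝ) ≤ m)]

/-- Continuity and a crude bound for the `j`-th series term on the line `re s = c > 0`. [folklore] -/
theorem continuous_seriesTerm_vertical {c : ℝ} (hc : 0 < c) (j : ℕ) :
    Continuous (fun y : ℝ ↦ 1 / (2 * ((j : ℂ) + 1)) - 1 / (((c : ℂ) + y * I) + 2 * ((j : ℂ) + 1))) ∧
      ∀ y : ℝ, ‖1 / (2 * ((j : ℂ) + 1)) - 1 / (((c : ℂ) + y * I) + 2 * ((j : ℂ) + 1))‖ ≤ 1 + 1 / c := by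
  have hne : ∀ y : ℝ, ((c : ℂ) + y * I) + 2 * ((j : ℂ) + 1) ≠ 0 := fun y h ↦ by
    have := congrArg Complex.re h; simp at this; linarith
  refine ⟨continuous_const.sub (continuous_const.div (by fun_prop) hne), fun y ↦ ?_⟩
  refine (norm_sub_le _ _).trans (add_le_add ?_ ?_)
  · rw [norm_div, norm_one]
    have : (2 : ℝ) ≤ ‖(2 * ((j : ℂ) + 1))‖ := by
      rw [show (2 * ((j : ℂ) + 1)) = (((2 * ((j : ℝ) + 1)) : ℝ) : ℂ) by push_cast; ring,
        Complex.norm_real, Real.norm_of_nonneg (by positivity)]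
      linarith [j.cast_nonneg (α := ℝ)]
    rw [div_le_one (by linarith)]; linarith
  · rw [norm_div, norm_one]
    apply one_div_le_one_div_of_le hc
    have := abs_re_le_norm (((c : ℂ) + y * I) + 2 * ((j : ℂ) + 1))
    simp at this
    rw [abs_of_pos (by positivity)] at this
    linarith

/-- **Termwise integration of the Gamma-factor series against a pair kernel.** For `y₀ > 0`,
`c > 0` and poles `re p₁, re p₂ ≠ c`: with `s = c + iy`,
`∑_j ∫ (1/(2(j+1)) − 1/(s+2(j+1))) y₀^s (1/(s−p₁) − 1/(s−p₂)) dy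
  = ∫ (1/s + Γ_ℝ'/Γ_ℝ(s) + (log π + γ)/2) y₀^s (1/(s−p₁) − 1/(s−p₂)) dy`
(the `j`-th integrand is `≪ (2j+1+c)^{-3/4}(j+1)^{-1}(1+|y|)^{-5/4}`, so Fubini applies). [folklore] -/
theorem hasSum_integral_seriesTerm {y₀ : ℝ} (hy : 0 < y₀) {c : ℝ} (hc : 0 < c) {p₁ p₂ : ℂ}
    (h1 : p₁.re ≠ c) (h2 : p₂.re ≠ c) :
    HasSum (fun j : ℕ ↦ ∫ y : ℝ, (1 / (2 * ((j : ℂ) + 1)) - 1 / (((c : ℂ) + y * I) + 2 * ((j : ℂ) + 1))) *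
        ((y₀ : ℂ) ^ ((c : ℂ) + y * I) * (1 / ((c : ℂ) + y * I - p₁) - 1 / ((c : ℂ) + y * I - p₂))))
      (∫ y : ℝ, (1 / ((c : ℂ) + y * I) + logDeriv Gammaℝ ((c : ℂ) + y * I) +
          ((Real.log π : ℂ) + (Real.eulerMascheroniConstant : ℂ)) / 2) *
        ((y₀ : ℂ) ^ ((c : ℂ) + y * I) * (1 / ((c : ℂ) + y * I - p₁) - 1 / ((c : ℂ) + y * I - p₂)))) := by
  obtain ⟨K, hK⟩ : ∃ K : ℝ → ℂ, K = fun y : ℝ ↦ (y₀ : ℂ) ^ ((c : ℂ) + y * I) *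
      (1 / ((c : ℂ) + y * I - p₁) - 1 / ((c : ℂ) + y * I - p₂)) := ⟨_, rfl⟩
  obtain ⟨F, hF⟩ : ∃ F : ℕ → ℝ → ℂ, F = fun (j : ℕ) (y : ℝ) ↦
      (1 / (2 * ((j : ℂ) + 1)) - 1 / (((c : ℂ) + y * I) + 2 * ((j : ℂ) + 1))) * K y := ⟨_, rfl⟩
  -- pointwise `HasSum` from the series for `1/s + Γℝ'/Γℝ`
  have hsum_y : ∀ y : ℝ, HasSum (fun j ↦ F j y)
      ((1 / ((c : ℂ) + y * I) + logDeriv Gammaℝ ((c : ℂ) + y * I) +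
        ((Real.log π : ℂ) + (Real.eulerMascheroniConstant : ℂ)) / 2) * K y) := by
    intro y
    rw [hF]
    exact (hasSum_inv_add_logDeriv_Gammaℝ (w := (c : ℂ) + y * I) (by simp; linarith)
      (half_vertical_ne_neg_nat hc y)).mul_right _
  -- integrability of the terms
  have hKint : Integrable K := by rw [hK]; exact integrable_cpow_mul_inv_sub_inv hy h1 h2
  have hFint : ∀ j, Integrable (F j) := fun j ↦ by
    obtain ⟨hcont, hbd⟩ := continuous_seriesTerm_vertical hc j
    rw [hF]
    exact hKint.bdd_mul hcont.aestronglyMeasurable (ae_of_all _ hbd)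
  -- the `L¹` bound `‖F j y‖ ≤ B_j (1+|y|)^{-1} (1+|y|)^{-1/4}`
  obtain ⟨D, hD0, hD⟩ := exists_norm_mul_inv_sub_inv_le c p₁ p₂ h1 h2
  have hbound : ∀ (j : ℕ) (y : ℝ), ‖F j y‖ ≤
      (y₀ ^ c * D * ((2 * (j : ℝ) + 1 + c) ^ (-(3 / 4 : ℝ)) / ((j : ℝ) + 1))) *
        ((1 / (1 + |y|)) * (1 + |y|) ^ (-(1 / 4 : ℝ))) := by
    intro j y
    have hne : ((c : ℂ) + y * I) + 2 * ((j : ℂ) + 1) ≠ 0 := fun h ↦ by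
      have := congrArg Complex.re h; simp at this; linarith
    rw [hF]
    dsimp only
    rw [norm_mul, norm_seriesTerm_eq _ _ hne, hK]
    dsimp only
    rw [norm_mul, norm_cpow_vertical hy]
    have hKn := hD y
    have hinv := inv_norm_add_le hc.le y j
    have hj0 : (0 : ℝ) < (j : ℝ) + 1 := by positivity
    have hs0 : 0 ≤ ‖(c : ℂ) + y * I‖ := norm_nonneg _
    have hk0 : 0 ≤ ‖1 / ((c : ℂ) + y * I - p₁) - 1 / ((c : ℂ) + y * I - p₂)‖ := norm_nonneg _
    have hn0 : 0 < ‖(c : ℂ) + y * I + 2 * ((j : ℂ) + 1)‖ := norm_pos_iff.2 hne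
    calc ‖(c : ℂ) + y * I‖ / (2 * ((j : ℝ) + 1) * ‖(c : ℂ) + y * I + 2 * ((j : ℂ) + 1)‖) *
          (y₀ ^ c * ‖1 / ((c : ℂ) + y * I - p₁) - 1 / ((c : ℂ) + y * I - p₂)‖)
        = y₀ ^ c / (2 * ((j : ℝ) + 1)) *
            (‖(c : ℂ) + y * I‖ * ‖1 / ((c : ℂ) + y * I - p₁) - 1 / ((c : ℂ) + y * I - p₂)‖) *
            (1 / ‖(c : ℂ) + y * I + 2 * ((j : ℂ) + 1)‖) := by
          field_simp
      _ ≤ y₀ ^ c / (2 * ((j : ℝ) + 1)) * (D / (1 + |y|)) *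
            (2 * ((2 * (j : ℝ) + 1 + c) ^ (-(3 / 4 : ℝ)) * (1 + |y|) ^ (-(1 / 4 : ℝ)))) := by
          apply mul_le_mul (mul_le_mul_of_nonneg_left hKn (by positivity)) hinv (by positivity)
            (by positivity)
      _ = _ := by field_simp
  -- integrability of the majorant `(1+|y|)^{-1}(1+|y|)^{-1/4} = (1+‖y‖)^{-5/4}`
  have hmaj : Integrable fun y : ℝ ↦ (1 / (1 + |y|)) * (1 + |y|) ^ (-(1 / 4 : ℝ)) := by
    have h : Integrable fun y : ℝ ↦ (1 + ‖y‖) ^ (-(5 / 4 : ℝ)) :=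
      integrable_one_add_norm (by rw [Module.finrank_self]; norm_num)
    refine h.congr (ae_of_all _ fun y ↦ ?_)
    simp only [Real.norm_eq_abs]
    rw [show (-(5 / 4 : ℝ)) = -1 + -(1 / 4 : ℝ) by norm_num, Real.rpow_add (by positivity),
      Real.rpow_neg_one, one_div]
    norm_num
  set J : ℝ := ∫ y : ℝ, (1 / (1 + |y|)) * (1 + |y|) ^ (-(1 / 4 : ℝ)) with hJ
  have hJ0 : 0 ≤ J := integral_nonneg fun y ↦ by positivity
  have hnormle : ∀ j : ℕ, ∫ y, ‖F j y‖ ≤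
      (y₀ ^ c * D * ((2 * (j : ℝ) + 1 + c) ^ (-(3 / 4 : ℝ)) / ((j : ℝ) + 1))) * J := by
    intro j
    rw [hJ, ← MeasureTheory.integral_const_mul]
    exact integral_mono (hFint j).norm (hmaj.const_mul _) (hbound j)
  -- summability of the `L¹` norms
  have hsumm : Summable fun j ↦ ∫ y, ‖F j y‖ := by
    have hp : Summable fun j : ℕ ↦ ((j : ℝ) + 1) ^ (-(7 / 4 : ℝ)) := by
      have := (summable_nat_add_iff 1).2 (Real.summable_nat_rpow.2 (by norm_num : (-(7 / 4 : ℝ)) < -1))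
      refine this.congr fun j ↦ ?_
      push_cast; ring_nf
    refine Summable.of_nonneg_of_le (fun j ↦ integral_nonneg fun y ↦ norm_nonneg _)
      (fun j ↦ (hnormle j).trans ?_) ((hp.mul_left (y₀ ^ c * D)).mul_right J)
    apply mul_le_mul_of_nonneg_right _ hJ0
    apply mul_le_mul_of_nonneg_left _ (by positivity)
    -- `(2j+1+c)^{-3/4}/(j+1) ≤ (j+1)^{-7/4}`
    have hj0 : (0 : ℝ) < (j : ℝ) + 1 := by positivity
    have hle : ((2 * (j : ℝ) + 1 + c)) ^ (-(3 / 4 : ℝ)) ≤ ((j : ℝ) + 1) ^ (-(3 / 4 : ℝ)) :=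
      Real.rpow_le_rpow_of_nonpos hj0 (by linarith) (by norm_num)
    rw [div_le_iff₀ hj0, show (-(7 / 4 : ℝ)) = -(3 / 4 : ℝ) + (-1) by norm_num,
      Real.rpow_add hj0, Real.rpow_neg_one]
    field_simp
    exact hle
  -- Fubini
  have hswap := integral_tsum_of_summable_integral_norm hFint hsumm
  have hS : Summable fun j ↦ ∫ y, F j y :=
    Summable.of_norm_bounded hsumm fun j ↦ norm_integral_le_integral_norm _
  have heq : (∑' j, ∫ y, F j y) = ∫ y : ℝ, (1 / ((c : ℂ) + y * I) + logDeriv Gammaℝ ((c : ℂ) + y * I) +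
      ((Real.log π : ℂ) + (Real.eulerMascheroniConstant : ℂ)) / 2) * K y := by
    rw [hswap]
    exact integral_congr_ae (ae_of_all _ fun y ↦ (hsum_y y).tsum_eq)
  have hres := hS.hasSum
  rw [heq, hK] at hres
  rw [hF, hK] at hres
  exact hres


/-! ## `1/s + Γℝ'/Γℝ(s)` on a vertical line: continuity, growth, integrability against the kernel -/

/-- On `re s = c > 0`: `1/s + Γ_ℝ'/Γ_ℝ(s) = 1/s − (log π)/2 + ψ(s/2)/2` (pointwise form of
`LFunctions.logDeriv_Gammaℝ`). [folklore] -/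
theorem inv_add_logDeriv_Gammaℝ_vertical {c : ℝ} (hc : 0 < c) (y : ℝ) :
    1 / ((c : ℂ) + y * I) + logDeriv Gammaℝ ((c : ℂ) + y * I) =
      1 / ((c : ℂ) + y * I) - (Real.log π : ℂ) / 2 +
        Complex.digamma (((c : ℂ) + y * I) / 2) / 2 := by
  rw [LFunctions.logDeriv_Gammaℝ (half_vertical_ne_neg_nat hc y), ← Complex.ofReal_log Real.pi_pos.le]
  ring

/-- Continuity of `y ↦ 1/(c+iy) + Γ_ℝ'/Γ_ℝ(c+iy) + C` for `c > 0`. [folklore] -/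
theorem continuous_inv_add_logDeriv_Gammaℝ_vertical {c : ℝ} (hc : 0 < c) (C : ℂ) :
    Continuous fun y : ℝ ↦ 1 / ((c : ℂ) + y * I) + logDeriv Gammaℝ ((c : ℂ) + y * I) + C := by
  have hψ : Continuous fun y : ℝ ↦ Complex.digamma (((c : ℂ) + y * I) / 2) :=
    Literature.Analysis.SpecialFunctions.Complex.continuousOn_digamma.comp_continuous
      (by fun_prop) fun y ↦ by simp; positivity
  have hne : ∀ y : ℝ, (c : ℂ) + y * I ≠ 0 := fun y h ↦ by
    have := congrArg Complex.re h; simp at this; linarith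
  have h1 : Continuous fun y : ℝ ↦ 1 / ((c : ℂ) + y * I) := continuous_const.div (by fun_prop) hne
  have h : Continuous fun y : ℝ ↦ 1 / ((c : ℂ) + y * I) - (Real.log π : ℂ) / 2 +
      Complex.digamma (((c : ℂ) + y * I) / 2) / 2 + C :=
    ((h1.sub continuous_const).add (hψ.div_const 2)).add continuous_const
  refine h.congr fun y ↦ ?_
  rw [inv_add_logDeriv_Gammaℝ_vertical hc y]

/-- **Growth on a vertical line**: for `c > 0` and any constant `C₁` there is `C` with
`‖1/(c+iy) + Γ_ℝ'/Γ_ℝ(c+iy) + C₁‖ ≤ C + log(1+|y|)` (`exists_norm_digamma_vertical_le`). [folklore] -/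
theorem exists_norm_inv_add_logDeriv_Gammaℝ_vertical_le {c : ℝ} (hc : 0 < c) (C₁ : ℂ) :
    ∃ C : ℝ, ∀ y : ℝ, ‖1 / ((c : ℂ) + y * I) + logDeriv Gammaℝ ((c : ℂ) + y * I) + C₁‖ ≤
      C + Real.log (1 + |y|) := by
  obtain ⟨C, hC⟩ := Literature.Analysis.SpecialFunctions.Complex.exists_norm_digamma_vertical_le
    (a := c / 2) (by positivity)
  refine ⟨1 / c + Real.log π / 2 + C / 2 + ‖C₁‖, fun y ↦ ?_⟩
  rw [inv_add_logDeriv_Gammaℝ_vertical hc y]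
  have hψ : ‖Complex.digamma (((c : ℂ) + y * I) / 2)‖ ≤ C + Real.log (1 + |y|) := by
    have e : ((c : ℂ) + y * I) / 2 = ((c / 2 : ℝ) : ℂ) + ((y / 2 : ℝ) : ℂ) * I := by push_cast; ring
    rw [e]
    refine (hC (y / 2)).trans ?_
    have : Real.log (1 + |y / 2|) ≤ Real.log (1 + |y|) := by
      refine Real.log_le_log (by positivity) ?_
      rw [abs_div, abs_two]; linarith [abs_nonneg y]
    linarith
  have h1 : ‖1 / ((c : ℂ) + y * I)‖ ≤ 1 / c := by
    rw [norm_div, norm_one]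
    apply one_div_le_one_div_of_le hc
    have := abs_re_le_norm ((c : ℂ) + y * I)
    simp at this
    rw [abs_of_pos hc] at this
    exact this
  have h2 : ‖(Real.log π : ℂ) / 2‖ = Real.log π / 2 := by
    rw [norm_div, Complex.norm_real, Real.norm_of_nonneg (Real.log_nonneg (by linarith [Real.pi_gt_three])),
      Complex.norm_two]
  have h3 : ‖Complex.digamma (((c : ℂ) + y * I) / 2) / 2‖ ≤ (C + Real.log (1 + |y|)) / 2 := by
    rw [norm_div, Complex.norm_two]; linarith
  have hlog0 : 0 ≤ Real.log (1 + |y|) := Real.log_nonneg (by linarith [abs_nonneg y])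
  calc ‖1 / ((c : ℂ) + y * I) - (Real.log π : ℂ) / 2 + Complex.digamma (((c : ℂ) + y * I) / 2) / 2 + C₁‖
      ≤ ‖1 / ((c : ℂ) + y * I) - (Real.log π : ℂ) / 2‖ +
          ‖Complex.digamma (((c : ℂ) + y * I) / 2) / 2‖ + ‖C₁‖ := norm_add₃_le
    _ ≤ (‖1 / ((c : ℂ) + y * I)‖ + ‖(Real.log π : ℂ) / 2‖) +
          ‖Complex.digamma (((c : ℂ) + y * I) / 2) / 2‖ + ‖C₁‖ := by
        gcongr; exact norm_sub_le _ _
    _ ≤ (1 / c + Real.log π / 2) + (C + Real.log (1 + |y|)) / 2 + ‖C₁‖ := by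
        rw [h2]; linarith
    _ ≤ 1 / c + Real.log π / 2 + C / 2 + ‖C₁‖ + Real.log (1 + |y|) := by linarith

/-- **Quadratic decay of the pair kernel on a vertical line**: `‖1/(s−p₁) − 1/(s−p₂)‖ ≤ D/(1+|y|)²`
for `s = c + iy`, `re p₁, re p₂ ≠ c`. [folklore] -/
theorem exists_norm_inv_sub_inv_le_sq (c : ℝ) (p₁ p₂ : ℂ) (h1 : p₁.re ≠ c) (h2 : p₂.re ≠ c) :
    ∃ D : ℝ, 0 < D ∧ ∀ y : ℝ,
      ‖1 / ((c : ℂ) + y * I - p₁) - 1 / ((c : ℂ) + y * I - p₂)‖ ≤ D / (1 + |y|) ^ 2 := by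
  set δ : ℝ := min |c - p₁.re| |c - p₂.re| with hδ
  have hδ0 : 0 < δ := lt_min (abs_pos.2 (sub_ne_zero.2 (Ne.symm h1))) (abs_pos.2 (sub_ne_zero.2 (Ne.symm h2)))
  set M : ℝ := max |p₁.im| |p₂.im| with hM
  have hM0 : 0 ≤ M := le_trans (abs_nonneg _) (le_max_left _ _)
  set κ : ℝ := δ / (M + 1 + δ) with hκ
  have hκ0 : 0 < κ := by positivity
  have hlow : ∀ (p : ℂ), δ ≤ |c - p.re| → |p.im| ≤ M → ∀ y : ℝ,
      κ * (1 + |y|) ≤ ‖(c : ℂ) + y * I - p‖ := by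
    intro p hp hpM y
    have hre : |c - p.re| ≤ ‖(c : ℂ) + y * I - p‖ := by
      have := abs_re_le_norm ((c : ℂ) + y * I - p); simpa using this
    have him : |y - p.im| ≤ ‖(c : ℂ) + y * I - p‖ := by
      have := abs_im_le_norm ((c : ℂ) + y * I - p); simpa using this
    have h3 : |y| - M ≤ |y - p.im| := by
      have := abs_sub_abs_le_abs_sub y p.im; linarith
    rw [hκ, div_mul_eq_mul_div, div_le_iff₀ (by positivity)]
    rcases le_or_gt (|y| - M) δ with hy | hy
    · nlinarith [abs_nonneg y]
    · nlinarith [abs_nonneg y]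
  refine ⟨‖p₁ - p₂‖ / κ ^ 2 + 1, by positivity, fun y ↦ ?_⟩
  have hq1 := hlow p₁ (min_le_left _ _) (le_max_left _ _) y
  have hq2 := hlow p₂ (min_le_right _ _) (le_max_right _ _) y
  have hpos1 : 0 < ‖(c : ℂ) + y * I - p₁‖ := lt_of_lt_of_le (by positivity) hq1
  have hpos2 : 0 < ‖(c : ℂ) + y * I - p₂‖ := lt_of_lt_of_le (by positivity) hq2
  have e : 1 / ((c : ℂ) + y * I - p₁) - 1 / ((c : ℂ) + y * I - p₂) =
      (p₁ - p₂) / (((c : ℂ) + y * I - p₁) * ((c : ℂ) + y * I - p₂)) := by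
    have d1 : (c : ℂ) + y * I - p₁ ≠ 0 := norm_pos_iff.1 hpos1
    have d2 : (c : ℂ) + y * I - p₂ ≠ 0 := norm_pos_iff.1 hpos2
    field_simp; ring
  rw [e, norm_div, norm_mul]
  have hy1 : 0 < 1 + |y| := by positivity
  calc ‖p₁ - p₂‖ / (‖(c : ℂ) + y * I - p₁‖ * ‖(c : ℂ) + y * I - p₂‖)
      ≤ ‖p₁ - p₂‖ / (κ * (1 + |y|) * (κ * (1 + |y|))) :=
        div_le_div_of_nonneg_left (norm_nonneg _) (by positivity)
          (mul_le_mul hq1 hq2 (by positivity) (norm_nonneg _))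
    _ = (‖p₁ - p₂‖ / κ ^ 2) / (1 + |y|) ^ 2 := by field_simp
    _ ≤ (‖p₁ - p₂‖ / κ ^ 2 + 1) / (1 + |y|) ^ 2 := by gcongr; linarith

/-- `log(1+u) ≤ 2 (1+u)^{1/2}` for `u ≥ 0`. [folklore] -/
theorem log_one_add_le_two_mul_sqrt {u : ℝ} (hu : 0 ≤ u) :
    Real.log (1 + u) ≤ 2 * (1 + u) ^ (1 / 2 : ℝ) := by
  have h := Real.log_le_rpow_div (by linarith : (0 : ℝ) ≤ 1 + u) (by norm_num : (0 : ℝ) < 1 / 2)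
  have e : (1 + u) ^ (1 / 2 : ℝ) / (1 / 2) = 2 * (1 + u) ^ (1 / 2 : ℝ) := by ring
  linarith

/-- **Integrability of `(1/s + Γ_ℝ'/Γ_ℝ(s) + C₁)·y₀^s·(pair kernel)` on the line `re s = c > 0`**
(growth `≪ log(1+|y|)` against decay `≪ (1+|y|)^{-2}`). [folklore] -/
theorem integrable_gammaFactor_mul_kernel {c : ℝ} (hc : 0 < c) (C₁ : ℂ) {y₀ : ℝ} (hy : 0 < y₀)
    {p₁ p₂ : ℂ} (h1 : p₁.re ≠ c) (h2 : p₂.re ≠ c) :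
    Integrable fun y : ℝ ↦ (1 / ((c : ℂ) + y * I) + logDeriv Gammaℝ ((c : ℂ) + y * I) + C₁) *
      ((y₀ : ℂ) ^ ((c : ℂ) + y * I) * (1 / ((c : ℂ) + y * I - p₁) - 1 / ((c : ℂ) + y * I - p₂))) := by
  obtain ⟨C, hC⟩ := exists_norm_inv_add_logDeriv_Gammaℝ_vertical_le hc C₁
  obtain ⟨D, hD0, hD⟩ := exists_norm_inv_sub_inv_le_sq c p₁ p₂ h1 h2
  have hC0 : 0 ≤ C := by
    have := hC 0
    simp only [abs_zero, add_zero, Real.log_one] at this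
    exact le_trans (norm_nonneg _) this
  -- continuity
  have hcont : Continuous fun y : ℝ ↦ (1 / ((c : ℂ) + y * I) + logDeriv Gammaℝ ((c : ℂ) + y * I) + C₁) *
      ((y₀ : ℂ) ^ ((c : ℂ) + y * I) * (1 / ((c : ℂ) + y * I - p₁) - 1 / ((c : ℂ) + y * I - p₂))) := by
    refine (continuous_inv_add_logDeriv_Gammaℝ_vertical hc C₁).mul ?_
    refine (Continuous.const_cpow (by fun_prop) (Or.inl (ofReal_ne_zero.2 hy.ne'))).mul ?_
    exact (continuous_const.div (by fun_prop) (ofReal_add_mul_I_sub_ne_zero h1)).sub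
      (continuous_const.div (by fun_prop) (ofReal_add_mul_I_sub_ne_zero h2))
  -- domination by `(C+2) y₀^c D (1+|y|)^{-3/2}`
  have hmaj : Integrable fun y : ℝ ↦ (C + 2) * y₀ ^ c * D * (1 + ‖y‖) ^ (-(3 / 2 : ℝ)) :=
    (integrable_one_add_norm (by rw [Module.finrank_self]; norm_num)).const_mul _
  refine hmaj.mono' hcont.aestronglyMeasurable (ae_of_all _ fun y ↦ ?_)
  rw [norm_mul, norm_mul, norm_cpow_vertical hy, Real.norm_eq_abs]
  have hy1 : 0 < 1 + |y| := by positivity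
  have hlog : Real.log (1 + |y|) ≤ 2 * (1 + |y|) ^ (1 / 2 : ℝ) := log_one_add_le_two_mul_sqrt (abs_nonneg y)
  have hsqrt1 : 1 ≤ (1 + |y|) ^ (1 / 2 : ℝ) := Real.one_le_rpow (by linarith [abs_nonneg y]) (by norm_num)
  have hE : ‖1 / ((c : ℂ) + y * I) + logDeriv Gammaℝ ((c : ℂ) + y * I) + C₁‖ ≤
      (C + 2) * (1 + |y|) ^ (1 / 2 : ℝ) := by
    refine (hC y).trans ?_
    nlinarith
  have hK := hD y
  have e : (1 + |y|) ^ (-(3 / 2 : ℝ)) = (1 + |y|) ^ (1 / 2 : ℝ) / (1 + |y|) ^ 2 := by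
    rw [eq_div_iff (by positivity), ← Real.rpow_natCast, ← Real.rpow_add hy1]; norm_num
  rw [e]
  calc ‖1 / ((c : ℂ) + y * I) + logDeriv Gammaℝ ((c : ℂ) + y * I) + C₁‖ *
        (y₀ ^ c * ‖1 / ((c : ℂ) + y * I - p₁) - 1 / ((c : ℂ) + y * I - p₂)‖)
      ≤ ((C + 2) * (1 + |y|) ^ (1 / 2 : ℝ)) * (y₀ ^ c * (D / (1 + |y|) ^ 2)) := by
        apply mul_le_mul hE (mul_le_mul_of_nonneg_left hK (by positivity)) (by positivity) (by positivity)
    _ = (C + 2) * y₀ ^ c * D * ((1 + |y|) ^ (1 / 2 : ℝ) / (1 + |y|) ^ 2) := by ring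


/-! ## Evaluation of the `j`-th term -/

/-- **The `j`-th term, closing to the left** (`y₀ ≥ 1`): with `p = −2(j+1)` and
`k(s) = 1/(s−p₁) − 1/(s−p₂)`, `re p₁ < c < re p₂`, `re p₁ > −2`,
`∫ (1/(2(j+1)) − 1/(s+2(j+1))) y₀^s k(s) dy = 2π (y₀^{p₁}(1/(2(j+1)) − 1/(p₁+2(j+1))) − k(p) y₀^p)`
— the residue at `p₁` and, from the pole of the `j`-th term, the **trivial-zero term** `k(p) y₀^p`.
[folklore] -/
theorem integral_seriesTerm_mul_kernel_of_one_le {y₀ : ℝ} (hy : 1 ≤ y₀) {c : ℝ} {p₁ p₂ : ℂ}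
    (h1 : p₁.re < c) (h2 : c < p₂.re) (hp₁ : -2 < p₁.re) (j : ℕ) :
    ∫ y : ℝ, (1 / (2 * ((j : ℂ) + 1)) - 1 / (((c : ℂ) + y * I) + 2 * ((j : ℂ) + 1))) *
        ((y₀ : ℂ) ^ ((c : ℂ) + y * I) * (1 / ((c : ℂ) + y * I - p₁) - 1 / ((c : ℂ) + y * I - p₂))) =
      2 * π * ((y₀ : ℂ) ^ p₁ * (1 / (2 * ((j : ℂ) + 1)) - 1 / (p₁ + 2 * ((j : ℂ) + 1))) -
        (1 / (-(2 * ((j : ℂ) + 1)) - p₁) - 1 / (-(2 * ((j : ℂ) + 1)) - p₂)) *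
          (y₀ : ℂ) ^ (-(2 * ((j : ℂ) + 1)))) := by
  have hy0 : 0 < y₀ := one_pos.trans_le hy
  set p : ℂ := -(2 * ((j : ℂ) + 1)) with hp
  have hpre : p.re = -(2 * ((j : ℝ) + 1)) := by rw [hp]; simp
  have hpc : p.re < c := by rw [hpre]; linarith [j.cast_nonneg (α := ℝ)]
  have hpp₁ : p ≠ p₁ := fun h ↦ by
    have := congrArg Complex.re h; rw [hpre] at this; linarith [j.cast_nonneg (α := ℝ)]
  have hpp₂ : p ≠ p₂ := fun h ↦ by
    have := congrArg Complex.re h; rw [hpre] at this; linarith [j.cast_nonneg (α := ℝ)]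
  have hs_ne : ∀ (y : ℝ) (d : ℂ), d.re ≠ c → (c : ℂ) + y * I ≠ d := fun y d hd h ↦
    hd (by rw [← h]; simp)
  -- pointwise partial fractions
  have hpf : ∀ y : ℝ, (1 / (2 * ((j : ℂ) + 1)) - 1 / (((c : ℂ) + y * I) + 2 * ((j : ℂ) + 1))) *
      ((y₀ : ℂ) ^ ((c : ℂ) + y * I) * (1 / ((c : ℂ) + y * I - p₁) - 1 / ((c : ℂ) + y * I - p₂))) =
      (1 / (2 * ((j : ℂ) + 1)) - 1 / (p₁ - p)) * ((y₀ : ℂ) ^ ((c : ℂ) + y * I) *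
        (1 / ((c : ℂ) + y * I - p₁) - 1 / ((c : ℂ) + y * I - p₂))) -
      (1 / (p - p₁) - 1 / (p - p₂)) * ((y₀ : ℂ) ^ ((c : ℂ) + y * I) *
        (1 / ((c : ℂ) + y * I - p) - 1 / ((c : ℂ) + y * I - p₂))) := by
    intro y
    have hk := kernel_div_sub_eq (s := (c : ℂ) + y * I) (p := p) (s₁ := p₁) (s₂ := p₂)
      (hs_ne y p₁ h1.ne) (hs_ne y p₂ h2.ne') (hs_ne y p hpc.ne) hpp₁ hpp₂
    have e : ((c : ℂ) + y * I) + 2 * ((j : ℂ) + 1) = ((c : ℂ) + y * I) - p := by rw [hp]; ring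
    rw [e, sub_mul, show 1 / (((c : ℂ) + y * I) - p) * ((y₀ : ℂ) ^ ((c : ℂ) + y * I) *
        (1 / ((c : ℂ) + y * I - p₁) - 1 / ((c : ℂ) + y * I - p₂))) =
        (y₀ : ℂ) ^ ((c : ℂ) + y * I) * ((1 / ((c : ℂ) + y * I - p₁) - 1 / ((c : ℂ) + y * I - p₂)) /
          (((c : ℂ) + y * I) - p)) by rw [div_eq_mul_one_div _ (((c : ℂ) + y * I) - p)]; ring, hk]
    ring
  simp_rw [hpf]
  rw [integral_sub ((integrable_cpow_mul_inv_sub_inv hy0 h1.ne h2.ne').const_mul _)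
    ((integrable_cpow_mul_inv_sub_inv hy0 hpc.ne h2.ne').const_mul _),
    MeasureTheory.integral_const_mul, MeasureTheory.integral_const_mul,
    integral_cpow_mul_inv_sub_inv_of_one_le hy h1 h2,
    integral_cpow_mul_inv_sub_inv_of_one_le hy hpc h2]
  have e2 : p₁ - p = p₁ + 2 * ((j : ℂ) + 1) := by rw [hp]; ring
  rw [e2]
  ring

/-- **The `j`-th term, closing to the right** (`0 < y₀ ≤ 1`): with `k(s) = 1/(s−p₁) − 1/(s−p₂)`,
`re p₁ < c < re p₂`, `re p₁ > −2`,
`∫ (1/(2(j+1)) − 1/(s+2(j+1))) y₀^s k(s) dy = 2π y₀^{p₂} (1/(2(j+1)) − 1/(p₂+2(j+1)))`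
(the only pole to the right of the line is `p₂`). [folklore] -/
theorem integral_seriesTerm_mul_kernel_of_le_one {y₀ : ℝ} (hy0 : 0 < y₀) (hy : y₀ ≤ 1) {c : ℝ}
    {p₁ p₂ : ℂ} (h1 : p₁.re < c) (h2 : c < p₂.re) (hp₁ : -2 < p₁.re) (j : ℕ) :
    ∫ y : ℝ, (1 / (2 * ((j : ℂ) + 1)) - 1 / (((c : ℂ) + y * I) + 2 * ((j : ℂ) + 1))) *
        ((y₀ : ℂ) ^ ((c : ℂ) + y * I) * (1 / ((c : ℂ) + y * I - p₁) - 1 / ((c : ℂ) + y * I - p₂))) =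
      2 * π * ((y₀ : ℂ) ^ p₂ * (1 / (2 * ((j : ℂ) + 1)) - 1 / (p₂ + 2 * ((j : ℂ) + 1)))) := by
  set p : ℂ := -(2 * ((j : ℂ) + 1)) with hp
  have hpre : p.re = -(2 * ((j : ℝ) + 1)) := by rw [hp]; simp
  have hpc : p.re < c := by rw [hpre]; linarith [j.cast_nonneg (α := ℝ)]
  have hpp₁ : p ≠ p₁ := fun h ↦ by
    have := congrArg Complex.re h; rw [hpre] at this; linarith [j.cast_nonneg (α := ℝ)]
  have hpp₂ : p ≠ p₂ := fun h ↦ by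
    have := congrArg Complex.re h; rw [hpre] at this; linarith [j.cast_nonneg (α := ℝ)]
  have hs_ne : ∀ (y : ℝ) (d : ℂ), d.re ≠ c → (c : ℂ) + y * I ≠ d := fun y d hd h ↦
    hd (by rw [← h]; simp)
  have hpf : ∀ y : ℝ, (1 / (2 * ((j : ℂ) + 1)) - 1 / (((c : ℂ) + y * I) + 2 * ((j : ℂ) + 1))) *
      ((y₀ : ℂ) ^ ((c : ℂ) + y * I) * (1 / ((c : ℂ) + y * I - p₁) - 1 / ((c : ℂ) + y * I - p₂))) =
      (1 / (2 * ((j : ℂ) + 1)) - 1 / (p₁ - p)) * ((y₀ : ℂ) ^ ((c : ℂ) + y * I) *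
        (1 / ((c : ℂ) + y * I - p₁) - 1 / ((c : ℂ) + y * I - p₂))) -
      (1 / (p - p₁) - 1 / (p - p₂)) * ((y₀ : ℂ) ^ ((c : ℂ) + y * I) *
        (1 / ((c : ℂ) + y * I - p) - 1 / ((c : ℂ) + y * I - p₂))) := by
    intro y
    have hk := kernel_div_sub_eq (s := (c : ℂ) + y * I) (p := p) (s₁ := p₁) (s₂ := p₂)
      (hs_ne y p₁ h1.ne) (hs_ne y p₂ h2.ne') (hs_ne y p hpc.ne) hpp₁ hpp₂
    have e : ((c : ℂ) + y * I) + 2 * ((j : ℂ) + 1) = ((c : ℂ) + y * I) - p := by rw [hp]; ring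
    rw [e, sub_mul, show 1 / (((c : ℂ) + y * I) - p) * ((y₀ : ℂ) ^ ((c : ℂ) + y * I) *
        (1 / ((c : ℂ) + y * I - p₁) - 1 / ((c : ℂ) + y * I - p₂))) =
        (y₀ : ℂ) ^ ((c : ℂ) + y * I) * ((1 / ((c : ℂ) + y * I - p₁) - 1 / ((c : ℂ) + y * I - p₂)) /
          (((c : ℂ) + y * I) - p)) by rw [div_eq_mul_one_div _ (((c : ℂ) + y * I) - p)]; ring, hk]
    ring
  simp_rw [hpf]
  rw [integral_sub ((integrable_cpow_mul_inv_sub_inv hy0 h1.ne h2.ne').const_mul _)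
    ((integrable_cpow_mul_inv_sub_inv hy0 hpc.ne h2.ne').const_mul _),
    MeasureTheory.integral_const_mul, MeasureTheory.integral_const_mul,
    integral_cpow_mul_inv_sub_inv_of_le_one hy0 hy h1 h2,
    integral_cpow_mul_inv_sub_inv_of_le_one hy0 hy hpc h2]
  have d1 : p₁ - p ≠ 0 := sub_ne_zero.2 (Ne.symm hpp₁)
  have d2 : p - p₁ ≠ 0 := sub_ne_zero.2 hpp₁
  have d3 : p - p₂ ≠ 0 := sub_ne_zero.2 hpp₂
  have d4 : p₂ + 2 * ((j : ℂ) + 1) ≠ 0 := by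
    rw [show p₂ + 2 * ((j : ℂ) + 1) = p₂ - p by rw [hp]; ring]; exact sub_ne_zero.2 (Ne.symm hpp₂)
  have d5 : (2 * ((j : ℂ) + 1)) ≠ 0 := by
    intro h; have := congrArg Complex.re h; simp at this; linarith
  have e2 : p₂ + 2 * ((j : ℂ) + 1) = p₂ - p := by rw [hp]; ring
  rw [e2]
  field_simp
  ring

end Montgomery
end Literature.NumberTheory.LFunctions
end
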